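import Summits.BirchSwinnertonDyer.BirchSwinnertonDyer.Theorems.SignedLowerHalvesKobayashiLowerHalfLargeImageCongruenceShapeBound
import HarnessLib

/-!
# Route `SignedLowerHalves`, crux `KobayashiLowerHalfLargeImage` (item stmt-BirchSwinnertonDyer-19001):
# the congruence road, lower-bound form — PROPAGATION of Kobayashi's main conjecture along a
# `p`-congruence from the partner's main conjecture + BOTH two-engine certificates, and the consumers
# at the pair (cell `bsd-ssimc`, seat `bsd-ssimc-k3-c3` gen 8, object «CONG-λ-BOUND» part 2;
# `--supports stmt-BirchSwinnertonDyer-19001 --as helper`; closes nothing)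

PARTITION (cell bsd-ssimc): X7 (A7) × item 3's ENGINE-FREE CORE at `p = 3`, the cells whose known
congruence partner lies ON the Fouquet–Wan locus but is not tight in that colour (`11200bm1` odd ↔ `320b1`,
`379456el1` even ↔ `4928bb1`) — types-the-object-of; closes PER PAIR only (records are separate files;
with an OPEN binder on the partner they are CONDITIONAL); the crux stays OPEN; nothing booked; BSD is not
proved by any of this. THEOREMS ONLY. Companion of `…CongruenceShapeBound.lean` (§1–§3 there: the road
`kobayashiMainConjecture_of_lambdaTransfer_of_le_at_conductor` and the dischargers (D0)/(D1)/(D1′)).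

(D2) here: `KobayashiMainConjecture W′ p ε` for the PARTNER, from ANY source (a landed per-pair theorem,
Pollack–Rubin for a CM partner as in k3-c4's `SmallImageCongruenceRoad`, or an explicitly labelled OPEN
binder such as `FouquetWan2021_thm51_via_kobayashi74_OPEN` / `BurungaleSkinnerTianWan2024_thm13_OPEN`
applied to `W′`), together with the partner's OWN certificate `(μ, λ)(L^ε_p(E′)) = (0, l′)`, gives
`(μ, λ)(X^ε(E′)) = (0, l′)`; fed into §1 of the companion with the target's certificate and the books,
the main conjecture PROPAGATES from `E′` to `E` — B. D. Kim's ALGEBRAIC transfer (published) + two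
displayed certificates REPLACE the signed analytic transfer theorem (Kim–Lee–Ponsinet arXiv:1909.01764,
Corpuz–Lei arXiv:2508.09733: preprints, NOT used). SIGN DICTIONARY as in the companion.

References: [Kobayashi2003] Conj. (p. 2), Thm. 1.2, 4.1, (3.6); [BDKim2009] Cor. 2.13, 2.5, Prop. 2.6;
[Pollack2003] Def. 6.15, Prop. 6.9/6.10/6.18; [GreenbergVatsal2000] §3 Rem. 3.4; [BurungaleKobayashiOta2023] Cor. A.5;
[Washington1997] §13.2.
-/

set_option autoImplicit false
set_option linter.dupNamespace false
noncomputable section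

open scoped Classical MatrixGroups ModularForm BigOperators

open CongruenceSubgroup WeierstrassCurve NumberField IsDedekindDomain
  Literature.NumberTheory.EllipticCurves
  Literature.NumberTheory.EllipticCurves.ModularForms
  Literature.NumberTheory.EllipticCurves.Rank1Residual
  Literature.NumberTheory.EllipticCurves.Rank1Residual.Typed
  Literature.NumberTheory.EllipticCurves.Kobayashi2003 ZpExtension
  Literature.NumberTheory.EllipticCurves.GreenbergVatsal2000
  Literature.NumberTheory.EllipticCurves.BurungaleKobayashiOta2024
  Summit.BirchSwinnertonDyer.Rank1Residual.X1.MuLambda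
  Summit.BirchSwinnertonDyer.Rank1Residual.Supersingular

namespace Summit.BirchSwinnertonDyer.BirchSwinnertonDyer.Theorems.CongruenceRoad

variable {W : WeierstrassCurve ℚ} [W.IsElliptic] [W.IsGloballyMinimal] {p : ℕ} [Fact p.Prime]

/-! ### §4 (D2) Propagation: the partner's `(μ, λ)(X^ε)` from ITS main conjecture and ITS certificate -/

/-- **(D2) `(μ, λ)(X^ε(E′/ℚ_∞)) = (0, l′)` from `KobayashiMainConjecture W′ p ε` (ANY source) and the
partner's OWN two-engine certificate.** For `E′ = W′`, `p` odd good, `a_p(E′) = 0`, its newform `f₀′`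
and `hcert₀′ : (μ, λ)(L′^ε) = (0, l′)` for every `L′^ε` of `f₀′` in Kobayashi's labelling; `hMC′` the
main conjecture for `(E′, p, ε)` VERBATIM (a landed per-pair theorem, Pollack–Rubin, or an explicitly
labelled OPEN binder applied to `E′`): every dual datum `D′` (f.g. torsion) has `μ(D′.X) = 0` and
`λ(D′.X) = l′` — `char X^ε(E′) = (g′)`, `ι g′ = ϖ′·ι L′^ε` with `ϖ′ ∈ ℤ_p^×` (`h5`/`h3`), so
`(g′) = (L′^ε)`. Inputs BY NAME: `h5`, `h3`, Pollack (`hPollack`), modularity (`hmod`). The signed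
ANALYTIC transfer (preprints) is NOT used: the main conjecture PROPAGATES to a congruent curve through
§1 with BOTH certificates displayed. PER PARTNER; nothing asserted about any curve.
[cite: Kobayashi2003, (3.6) (p. 7) and Conjecture (p. 2)] [cite: GreenbergVatsal2000, §3 Remark 3.4]
[cite: Pollack2003, Prop. 6.18] [cite: Washington1997, §13.2] -/
theorem mu_eq_zero_and_lambdaInvariant_eq_of_mainConjecture_of_cert
    (h5 : realPeriodRat_eq_unit_mul_plusPeriod) (h3 : realPeriodRat_eq_unit_mul_plusPeriod_three)
    {W' : WeierstrassCurve ℚ} [W'.IsElliptic] [W'.IsGloballyMinimal]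
    (hPollack : ∀ {N : ℕ} [NeZero N] {f : CuspForm (Gamma0 N) 2},
      pollack_exists_plusMinusPAdicLFunction (W := W') (f := f) (p := p))
    (hmod : nonempty_modularParametrizationData)
    (hp : p ≠ 2) (hgood' : W'.HasGoodReductionAtPrime p) (hap' : W'.frobeniusTrace p = 0) (ε : ℤˣ)
    (hMC' : KobayashiMainConjecture W' p ε)
    [NeZero (W'.conductorNorm ℤ)] {f₀' : CuspForm (Gamma0 (W'.conductorNorm ℤ)) 2}
    (hf₀' : IsNewformOf W' f₀') {l' : ℕ}
    (hcert₀' : ∀ L' : IwasawaAlgebra p, IsSignedPAdicLFunction f₀' p ε L' → mu L' = 0 ∧ lam L' = l') :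
    ∀ (κ : ZpExtension ℚ p) (γ : Field.absoluteGaloisGroup ℚ), κ.IsCyclotomic →
      κ.IsTopGenerator γ → IsCyclotomicVariable p γ → ∀ (D' : SignedSelmerDualData W' κ γ ε)
      [Module.Finite (IwasawaAlgebra p) D'.X], Module.IsTorsion (IwasawaAlgebra p) D'.X →
      muInvariant p D'.X = 0 ∧ lambdaInvariant p D'.X = l' := by
  intro κ γ hκ hγ hγ' D' _ hX'
  -- modularity: the period ratio `ϖ′` of the newform `f₀′`
  obtain ⟨Dm⟩ := hmod W'
  have hff : Dm.f = f₀' := Dm.isNewformOf.unique hf₀'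
  obtain ⟨ϖ', hϖpos, hϖ', -⟩ := Dm.exists_rat_mul_realPeriodRat_eq_plusPeriod
  rw [hff] at hϖ'
  -- a Pollack pair for `f₀′` and Kobayashi's `L′^ε`
  obtain ⟨Lplus, Lminus, hPP'⟩ := exists_isPollackPair hPollack hp hf₀' hgood' hap'
  set L' := kobayashiL ε Lplus Lminus with hL'_def
  have hL' : IsSignedPAdicLFunction f₀' p ε L' := hPP'.isSignedPAdicLFunction_kobayashiL ε
  obtain ⟨hμL', hlamL'⟩ := hcert₀' L' hL'
  have hL'0 : L' ≠ 0 := by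
    rw [hL'_def]
    unfold kobayashiL
    split_ifs
    · exact hPP'.2.1
    · exact hPP'.1
  -- the main conjecture for `E′`: `char X^ε(E′) = (g′)`, `ι g′ = ϖ′ · ι L′^ε`
  obtain ⟨-, g', hg', hι'⟩ := hMC' κ γ hκ hγ hγ' f₀' hf₀' ϖ' hϖ' Lplus Lminus hPP' D'
  -- `ϖ′ ∈ ℤ_p^×`, so `g′ = C(u) · L′` and `(g′) = (L′)`
  have hirr' : W'.HasIrreducibleModPGaloisRep p :=
    hasIrreducibleModPGaloisRep_of_dvd_frobeniusTrace W' p hp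
      (W'.not_dvd_minimalDiscriminantInt_of_hasGoodReductionAtPrime' p hgood') (by rw [hap']; exact dvd_zero _)
  have hvϖ : padicValRat p ϖ' = 0 :=
    padicValRat_periodRatio_eq_zero h5 h3 W' p hp hgood' hirr' f₀' hf₀' ϖ' hϖ'
  obtain ⟨u, hu⟩ := exists_units_coe_eq_ratCast hϖpos.ne' hvϖ
  obtain ⟨hspan', hιu⟩ := span_C_units_mul_eq u L'
  have hgeq : g' = PowerSeries.C (u : ℤ_[p]) * L' :=
    iwasawaToPowerSeries_injective p (by rw [hι', hιu, hu])
  have hgL' : D'.charIdeal = Ideal.span {L'} := by rw [hg', hgeq, hspan']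
  refine ⟨?_, ?_⟩
  · rw [← Summit.BirchSwinnertonDyer.Rank1Residual.X1.MuPart.mu_generator_eq_muInvariant D'.X hX' hL'0 hgL']
    exact hμL'
  · rw [← Summit.BirchSwinnertonDyer.Rank1Residual.X1.ParitySqueeze.lam_generator_eq_lambdaInvariant D'.X
      hX' hL'0 hgL']
    exact hlamL'

/-- **(D2) in the shape §1 / p465598 consume**: `λ(X^ε(E′/ℚ_∞)) = l′` for every dual datum, from
`KobayashiMainConjecture W′ p ε` and the partner's certificate at the conductor. PER PARTNER.
[cite: Kobayashi2003, (3.6) (p. 7) and Conjecture (p. 2)] [cite: Pollack2003, Prop. 6.18] -/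
theorem lambdaInvariant_eq_of_mainConjecture_of_cert
    (h5 : realPeriodRat_eq_unit_mul_plusPeriod) (h3 : realPeriodRat_eq_unit_mul_plusPeriod_three)
    {W' : WeierstrassCurve ℚ} [W'.IsElliptic] [W'.IsGloballyMinimal]
    (hPollack : ∀ {N : ℕ} [NeZero N] {f : CuspForm (Gamma0 N) 2},
      pollack_exists_plusMinusPAdicLFunction (W := W') (f := f) (p := p))
    (hmod : nonempty_modularParametrizationData)
    (hp : p ≠ 2) (hgood' : W'.HasGoodReductionAtPrime p) (hap' : W'.frobeniusTrace p = 0) (ε : ℤˣ)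
    (hMC' : KobayashiMainConjecture W' p ε)
    [NeZero (W'.conductorNorm ℤ)] {f₀' : CuspForm (Gamma0 (W'.conductorNorm ℤ)) 2}
    (hf₀' : IsNewformOf W' f₀') {l' : ℕ}
    (hcert₀' : ∀ L' : IwasawaAlgebra p, IsSignedPAdicLFunction f₀' p ε L' → mu L' = 0 ∧ lam L' = l') :
    ∀ (κ : ZpExtension ℚ p) (γ : Field.absoluteGaloisGroup ℚ), κ.IsCyclotomic →
      κ.IsTopGenerator γ → IsCyclotomicVariable p γ → ∀ (D' : SignedSelmerDualData W' κ γ ε)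
      [Module.Finite (IwasawaAlgebra p) D'.X], Module.IsTorsion (IwasawaAlgebra p) D'.X →
      lambdaInvariant p D'.X = l' :=
  fun κ γ hκ hγ hγ' D' _ hX' ↦
    (mu_eq_zero_and_lambdaInvariant_eq_of_mainConjecture_of_cert h5 h3 hPollack hmod hp hgood' hap' ε hMC'
      hf₀' hcert₀' κ γ hκ hγ hγ' D' hX').2

/-- **(D2) as a LOWER bound** (the `hlam′` shape of `kobayashiMainConjecture_of_lambdaTransfer_of_le_at_conductor`):
`l′ ≤ λ(X^ε(E′/ℚ_∞))` for every dual datum, from `KobayashiMainConjecture W′ p ε` and the partner's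
certificate at the conductor. PER PARTNER. [cite: Kobayashi2003, (3.6) (p. 7) and Conjecture (p. 2)] [cite: Pollack2003, Prop. 6.18] -/
theorem le_lambdaInvariant_of_mainConjecture_of_cert
    (h5 : realPeriodRat_eq_unit_mul_plusPeriod) (h3 : realPeriodRat_eq_unit_mul_plusPeriod_three)
    {W' : WeierstrassCurve ℚ} [W'.IsElliptic] [W'.IsGloballyMinimal]
    (hPollack : ∀ {N : ℕ} [NeZero N] {f : CuspForm (Gamma0 N) 2},
      pollack_exists_plusMinusPAdicLFunction (W := W') (f := f) (p := p))
    (hmod : nonempty_modularParametrizationData)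
    (hp : p ≠ 2) (hgood' : W'.HasGoodReductionAtPrime p) (hap' : W'.frobeniusTrace p = 0) (ε : ℤˣ)
    (hMC' : KobayashiMainConjecture W' p ε)
    [NeZero (W'.conductorNorm ℤ)] {f₀' : CuspForm (Gamma0 (W'.conductorNorm ℤ)) 2}
    (hf₀' : IsNewformOf W' f₀') {l' : ℕ}
    (hcert₀' : ∀ L' : IwasawaAlgebra p, IsSignedPAdicLFunction f₀' p ε L' → mu L' = 0 ∧ lam L' = l') :
    ∀ (κ : ZpExtension ℚ p) (γ : Field.absoluteGaloisGroup ℚ), κ.IsCyclotomic →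
      κ.IsTopGenerator γ → IsCyclotomicVariable p γ → ∀ (D' : SignedSelmerDualData W' κ γ ε)
      [Module.Finite (IwasawaAlgebra p) D'.X], Module.IsTorsion (IwasawaAlgebra p) D'.X →
      l' ≤ lambdaInvariant p D'.X :=
  fun κ γ hκ hγ hγ' D' _ hX' ↦
    ((mu_eq_zero_and_lambdaInvariant_eq_of_mainConjecture_of_cert h5 h3 hPollack hmod hp hgood' hap' ε hMC'
      hf₀' hcert₀' κ γ hκ hγ hγ' D' hX').2).symm.le

/-- **(D2) from an ODD-layer Mazur–Tate row of the partner** (`ε = −1`: `n′` odd, `Θ′ ≠ 0`, `μ(Θ′) = 0`,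
`λ(Θ′) = deg ω_{n′}^+ + l′`): `λ(X^{−1}(E′)) = l′` for every dual datum, given
`KobayashiMainConjecture W′ p (-1)`. PER PARTNER. [cite: Pollack2003, Def. 6.15, Prop. 6.9, 6.10 and 6.18]
[cite: Kobayashi2003, Conjecture (p. 2)] -/
theorem lambdaInvariant_eq_of_mainConjecture_of_mazurTate_neg_one
    (h5 : realPeriodRat_eq_unit_mul_plusPeriod) (h3 : realPeriodRat_eq_unit_mul_plusPeriod_three)
    {W' : WeierstrassCurve ℚ} [W'.IsElliptic] [W'.IsGloballyMinimal]
    (hPollack : ∀ {N : ℕ} [NeZero N] {f : CuspForm (Gamma0 N) 2},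
      pollack_exists_plusMinusPAdicLFunction (W := W') (f := f) (p := p))
    (hmod : nonempty_modularParametrizationData)
    (hp : p ≠ 2) (hgood' : W'.HasGoodReductionAtPrime p) (hap' : W'.frobeniusTrace p = 0)
    (hMC' : KobayashiMainConjecture W' p (-1))
    [NeZero (W'.conductorNorm ℤ)] {f₀' : CuspForm (Gamma0 (W'.conductorNorm ℤ)) 2}
    (hf₀' : IsNewformOf W' f₀') {n' l' : ℕ} (hn' : Odd n') {Θ' : IwasawaAlgebra p}
    (hΘ' : iwasawaToPowerSeries p Θ' =
      ((mazurTateElement f₀' p n').map (algebraMap ℚ ℚ_[p]) : PowerSeries ℚ_[p]))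
    (hΘ'0 : Θ' ≠ 0) (hμ' : mu Θ' = 0) (hlamΘ' : lam Θ' = (cyclotomicOmegaPlus p n').natDegree + l') :
    ∀ (κ : ZpExtension ℚ p) (γ : Field.absoluteGaloisGroup ℚ), κ.IsCyclotomic →
      κ.IsTopGenerator γ → IsCyclotomicVariable p γ → ∀ (D' : SignedSelmerDualData W' κ γ (-1))
      [Module.Finite (IwasawaAlgebra p) D'.X], Module.IsTorsion (IwasawaAlgebra p) D'.X →
      lambdaInvariant p D'.X = l' :=
  lambdaInvariant_eq_of_mainConjecture_of_cert h5 h3 hPollack hmod hp hgood' hap' (-1) hMC' hf₀'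
    (fun _ hL ↦ lam_signed_neg_one_eq_of_mazurTate' hp hf₀' hgood' hap' hL hn' hΘ' hΘ'0 hμ' hlamΘ')

/-- **(D2) from an EVEN-layer Mazur–Tate row of the partner** (`ε = 1`: `n′` even,
`λ(Θ′) = deg ω_{n′}^- + l′`): `λ(X^{1}(E′)) = l′`, given `KobayashiMainConjecture W′ p 1`. PER PARTNER.
[cite: Pollack2003, Def. 6.15, Prop. 6.9, 6.10 and 6.18] [cite: Kobayashi2003, Conjecture (p. 2)] -/
theorem lambdaInvariant_eq_of_mainConjecture_of_mazurTate_one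
    (h5 : realPeriodRat_eq_unit_mul_plusPeriod) (h3 : realPeriodRat_eq_unit_mul_plusPeriod_three)
    {W' : WeierstrassCurve ℚ} [W'.IsElliptic] [W'.IsGloballyMinimal]
    (hPollack : ∀ {N : ℕ} [NeZero N] {f : CuspForm (Gamma0 N) 2},
      pollack_exists_plusMinusPAdicLFunction (W := W') (f := f) (p := p))
    (hmod : nonempty_modularParametrizationData)
    (hp : p ≠ 2) (hgood' : W'.HasGoodReductionAtPrime p) (hap' : W'.frobeniusTrace p = 0)
    (hMC' : KobayashiMainConjecture W' p 1)
    [NeZero (W'.conductorNorm ℤ)] {f₀' : CuspForm (Gamma0 (W'.conductorNorm ℤ)) 2}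
    (hf₀' : IsNewformOf W' f₀') {n' l' : ℕ} (hn' : Even n') {Θ' : IwasawaAlgebra p}
    (hΘ' : iwasawaToPowerSeries p Θ' =
      ((mazurTateElement f₀' p n').map (algebraMap ℚ ℚ_[p]) : PowerSeries ℚ_[p]))
    (hΘ'0 : Θ' ≠ 0) (hμ' : mu Θ' = 0) (hlamΘ' : lam Θ' = (cyclotomicOmegaMinus p n').natDegree + l') :
    ∀ (κ : ZpExtension ℚ p) (γ : Field.absoluteGaloisGroup ℚ), κ.IsCyclotomic →
      κ.IsTopGenerator γ → IsCyclotomicVariable p γ → ∀ (D' : SignedSelmerDualData W' κ γ 1)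
      [Module.Finite (IwasawaAlgebra p) D'.X], Module.IsTorsion (IwasawaAlgebra p) D'.X →
      lambdaInvariant p D'.X = l' :=
  lambdaInvariant_eq_of_mainConjecture_of_cert h5 h3 hPollack hmod hp hgood' hap' 1 hMC' hf₀'
    (fun _ hL ↦ lam_signed_one_eq_of_mazurTate' hp hf₀' hgood' hap' hL hn' hΘ' hΘ'0 hμ' hlamΘ')

/-! ### §5 Consumers at the pair: the crux's conclusion and `BSD(E,p)` in analytic rank one -/

/-- **Item 3's statement AT THE PAIR from the lower-bound road**: `∃ ε, KobayashiLowerDivisibility W p ε`.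
PER PAIR; closes nothing. [cite: Kobayashi2003, Conjecture (p. 2) and Thm. 4.1 (p. 8)] [cite: BDKim2009, Cor. 2.13 (p. 187)] -/
theorem exists_kobayashiLowerDivisibility_of_lambdaTransfer_of_le_at_conductor
    (h12 : Kobayashi2003.thm12_signedSelmerDual_finite_torsion)
    (h41 : Kobayashi2003.thm41_signedCharIdeal_divisibility)
    (h5 : realPeriodRat_eq_unit_mul_plusPeriod) (h3 : realPeriodRat_eq_unit_mul_plusPeriod_three)
    (hL20 : Wuthrich2014.lemma20_surjective_threeAdic_of_semistable)
    (hKim : BDKim2009.cor213_signedLambda_add_sum_delta_eq_of_torsionIso)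
    (hp : p ≠ 2) (hgood : W.HasGoodReductionAtPrime p) (hap : W.frobeniusTrace p = 0)
    (hs : Surj W p) (ε : ℤˣ) {l : ℕ}
    [NeZero (W.conductorNorm ℤ)] {f₀ : CuspForm (Gamma0 (W.conductorNorm ℤ)) 2} (hf₀ : IsNewformOf W f₀)
    (hcert₀ : ∀ L : IwasawaAlgebra p, IsSignedPAdicLFunction f₀ p ε L → mu L = 0 ∧ lam L = l)
    {W' : WeierstrassCurve ℚ} [W'.IsElliptic] [W'.IsGloballyMinimal]
    (hgood' : W'.HasGoodReductionAtPrime p) (hap' : W'.frobeniusTrace p = 0)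
    (he : ∃ e : geomTorsion W (p : ℤ) ≃+ geomTorsion W' (p : ℤ),
      ∀ (σ : Field.absoluteGaloisGroup ℚ) (P : geomTorsion W (p : ℤ)), e (σ • P) = σ • e P)
    {l' : ℕ}
    (hlam' : ∀ (κ : ZpExtension ℚ p) (γ : Field.absoluteGaloisGroup ℚ), κ.IsCyclotomic →
      κ.IsTopGenerator γ → IsCyclotomicVariable p γ → ∀ (D' : SignedSelmerDualData W' κ γ ε)
      [Module.Finite (IwasawaAlgebra p) D'.X], Module.IsTorsion (IwasawaAlgebra p) D'.X →
      l' ≤ lambdaInvariant p D'.X)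
    (S₀ : Finset (HeightOneSpectrum (𝓞 ℚ))) (hS₀ : ∀ v ∈ S₀, ((p : ℕ) : 𝓞 ℚ) ∉ v.asIdeal)
    (hS₀W : ∀ v : HeightOneSpectrum (𝓞 ℚ), ¬ W.HasGoodReductionAt v → v ∈ S₀)
    (hS₀W' : ∀ v : HeightOneSpectrum (𝓞 ℚ), ¬ W'.HasGoodReductionAt v → v ∈ S₀)
    (hδ : l + ∑ v ∈ S₀, delta W p v ≤ l' + ∑ v ∈ S₀, delta W' p v) :
    ∃ ε : ℤˣ, KobayashiLowerDivisibility W p ε :=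
  ⟨ε, kobayashiLowerDivisibility_of_mainConjecture
    (kobayashiMainConjecture_of_lambdaTransfer_of_le_at_conductor h12 h41 h5 h3 hL20 hKim hp hgood hap hs ε
      hf₀ hcert₀ hgood' hap' he hlam' S₀ hS₀ hS₀W hS₀W' hδ)⟩

/-- **X7 ∩ {r_an = 1} ∩ {surj}: `BSD(E,p)` from the lower-bound road**, through the tree's rank-one ±
road `X7.bsdp_of_kobayashiMainConjecture_of_corA5_of_analyticRank_eq_one` (BKO 2024 Cor. A.5 `hA5` with
its two displayed referee flags; `hmodr`; `hGZK`). PER PAIR; closes nothing.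
[cite: BurungaleKobayashiOta2023, App. A Cor. A.5] [cite: Kobayashi2003, Thm. 7.4 (p. 13) and Conjecture (p. 2)]
[cite: BDKim2009, Cor. 2.13 (p. 187)] -/
theorem X7RankOne.bsdp_of_lambdaTransfer_of_le_at_conductor
    (h12 : Kobayashi2003.thm12_signedSelmerDual_finite_torsion)
    (h41 : Kobayashi2003.thm41_signedCharIdeal_divisibility)
    (h5 : realPeriodRat_eq_unit_mul_plusPeriod) (h3 : realPeriodRat_eq_unit_mul_plusPeriod_three)
    (hL20 : Wuthrich2014.lemma20_surjective_threeAdic_of_semistable)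
    (hKim : BDKim2009.cor213_signedLambda_add_sum_delta_eq_of_torsionIso)
    (hA5 : corA5_pPart_of_signedCharIdeal_eq) (hmodr : hasEntireLFunction_rat)
    (hGZK : rank_eq_analyticRank_of_analyticRank_le_one)
    (hp : p ≠ 2) (hX : ClassX7 W p) (hap : W.frobeniusTrace p = 0) (hs : Surj W p)
    (h1 : W.analyticRank = 1) (ε : ℤˣ) {l : ℕ}
    [NeZero (W.conductorNorm ℤ)] {f₀ : CuspForm (Gamma0 (W.conductorNorm ℤ)) 2} (hf₀ : IsNewformOf W f₀)
    (hcert₀ : ∀ L : IwasawaAlgebra p, IsSignedPAdicLFunction f₀ p ε L → mu L = 0 ∧ lam L = l)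
    {W' : WeierstrassCurve ℚ} [W'.IsElliptic] [W'.IsGloballyMinimal]
    (hgood' : W'.HasGoodReductionAtPrime p) (hap' : W'.frobeniusTrace p = 0)
    (he : ∃ e : geomTorsion W (p : ℤ) ≃+ geomTorsion W' (p : ℤ),
      ∀ (σ : Field.absoluteGaloisGroup ℚ) (P : geomTorsion W (p : ℤ)), e (σ • P) = σ • e P)
    {l' : ℕ}
    (hlam' : ∀ (κ : ZpExtension ℚ p) (γ : Field.absoluteGaloisGroup ℚ), κ.IsCyclotomic →
      κ.IsTopGenerator γ → IsCyclotomicVariable p γ → ∀ (D' : SignedSelmerDualData W' κ γ ε)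
      [Module.Finite (IwasawaAlgebra p) D'.X], Module.IsTorsion (IwasawaAlgebra p) D'.X →
      l' ≤ lambdaInvariant p D'.X)
    (S₀ : Finset (HeightOneSpectrum (𝓞 ℚ))) (hS₀ : ∀ v ∈ S₀, ((p : ℕ) : 𝓞 ℚ) ∉ v.asIdeal)
    (hS₀W : ∀ v : HeightOneSpectrum (𝓞 ℚ), ¬ W.HasGoodReductionAt v → v ∈ S₀)
    (hS₀W' : ∀ v : HeightOneSpectrum (𝓞 ℚ), ¬ W'.HasGoodReductionAt v → v ∈ S₀)
    (hδ : l + ∑ v ∈ S₀, delta W p v ≤ l' + ∑ v ∈ S₀, delta W' p v) : BSDp W p :=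
  X7.bsdp_of_kobayashiMainConjecture_of_corA5_of_analyticRank_eq_one W p hA5 hmodr hGZK hp hX hap h1 ε
    (kobayashiMainConjecture_of_lambdaTransfer_of_le_at_conductor h12 h41 h5 h3 hL20 hKim hp hX.1.1 hap hs ε
      hf₀ hcert₀ hgood' hap' he hlam' S₀ hS₀ hS₀W hS₀W' hδ)

end Summit.BirchSwinnertonDyer.BirchSwinnertonDyer.Theorems.CongruenceRoad

end
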